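import Mathlib
import Literature.Geometry.Lorentzian.ReggeWheelerPeeledResidual

/-!
# The peeled residual from last-rung bounds, II: monotonicity and Hardy size

Continuation of `ReggeWheelerPeeledResidual`: under `PeeledLastRung` (last rung of a recessive Crum
chain over the Regge–Wheeler family, `η = −yW − 1` within `κε` of the shift family `a/(y − a)` with two
derivatives, `κ ≤ 1/10`, `r ≥ 24M`, `0 ≤ a ≤ y/4`) we prove

* `hasDerivAt_residual`, `residual_deriv_le` : `Q` is differentiable on `(a′, ∞)` with
  `Q′ ≤ −ε/(2y³) < 0` (pure-inequality core `deriv_core`), hence `residual_strictAntiOn`;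
* `residual_le` : `Q ≤ 9M/r³`; `sq_mul_residual_translate_le` : `t² Q(x_f + t) ≤ 12M/r(x_f)`;
* `residual_subHardy` : the three registered conclusions of stub R (`Q ≥ 0` on `(a′, ∞)`, `Q` antitone
  on `[x_f, ∞)`, `t² Q(x_f + t) ≤ 1/16` for `t > 0`) once `x_f > a′` and `r(x_f) ≥ 192 M`.
[folklore]
-/

noncomputable section

open Set Filter Topology

namespace Literature.Geometry.Lorentzian

namespace ReggeWheeler

namespace PeeledLastRung

variable {M : ℝ} {r : ℝ → ℝ} {xc : ℝ} {W Up Q η' η'' : ℝ → ℝ} {a' a κ : ℝ}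

/-- `lineDefectDeriv` is `dε/dx` (restating `hasDerivAt_strDefect_comp`). [folklore] -/
theorem hasDerivAt_lineDefect (h : PeeledLastRung M r xc W Up Q η' η'' a' a κ) (x : ℝ) :
    HasDerivAt (fun t => strDefect M (r t)) (lineDefectDeriv M r x) x :=
  hasDerivAt_strDefect_comp h.tortoise x

/-- **The residual is differentiable on `(a′, ∞)`**, with derivative `N′/y² − 2(1−ε)N/y³` where
`N = η + η² + yη′ + ε(1+η)` and `N′ = η′(2 + 2η) + yη″ + ε′(1+η)`. [folklore] -/
theorem hasDerivAt_residual (h : PeeledLastRung M r xc W Up Q η' η'' a' a κ) {x : ℝ} (hx : a' < x) :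
    HasDerivAt Q
      ((η' x * (2 + 2 * (-strRadius M (r x) * W x - 1)) + strRadius M (r x) * η'' x
          + lineDefectDeriv M r x * (1 + (-strRadius M (r x) * W x - 1))) / strRadius M (r x) ^ 2
        - 2 * (1 - strDefect M (r x)) *
          ((-strRadius M (r x) * W x - 1) + (-strRadius M (r x) * W x - 1) ^ 2
            + strRadius M (r x) * η' x + strDefect M (r x) * (1 + (-strRadius M (r x) * W x - 1)))
          / strRadius M (r x) ^ 3) x := by
  have hM := h.tortoise.mass_pos
  have hypos : ∀ t, 0 < strRadius M (r t) := fun t => strRadius_pos hM.le (h.tortoise.two_mul_lt t)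
  -- N as a function and its derivative
  set η : ℝ → ℝ := fun t => -strRadius M (r t) * W t - 1 with hη
  set N : ℝ → ℝ := fun t => η t + η t ^ 2 + strRadius M (r t) * η' t
    + strDefect M (r t) * (1 + η t) with hN
  have hηd : HasDerivAt η (η' x) x := h.hasDerivAt_eta x hx
  have hyd := hasDerivAt_strRadius_comp h.tortoise x
  have hεd := h.hasDerivAt_lineDefect x
  have hη'd := h.hasDerivAt_eta' x hx
  have hNd : HasDerivAt N
      (η' x * (2 + 2 * η x) + strRadius M (r x) * η'' x
        + lineDefectDeriv M r x * (1 + η x)) x := by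
    have h1 := hηd.fun_add (hηd.fun_pow 2)
    have h2 := hyd.fun_mul hη'd
    have h3 := hεd.fun_mul (hηd.const_add 1)
    have h4 := (h1.fun_add h2).fun_add h3
    refine h4.congr_deriv ?_
    simp only [Nat.cast_ofNat]
    ring
  -- F = N / y²
  have hy2d : HasDerivAt (fun t => strRadius M (r t) ^ 2)
      (2 * strRadius M (r x) * (1 - strDefect M (r x))) x := by
    simpa using hyd.fun_pow 2
  have hy2ne : strRadius M (r x) ^ 2 ≠ 0 := (pow_pos (hypos x) 2).ne'
  have hFd := hNd.fun_div hy2d hy2ne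
  -- Q agrees with N/y² near x
  have hQF : Q =ᶠ[𝓝 x] fun t => N t / strRadius M (r t) ^ 2 := by
    filter_upwards [Ioi_mem_nhds hx] with t ht
    have e := h.sq_mul_residual_eq ht
    have hyt : strRadius M (r t) ^ 2 ≠ 0 := (pow_pos (hypos t) 2).ne'
    rw [eq_div_iff hyt, mul_comm]
    simpa [hN, hη] using e
  have hQd := hFd.congr_of_eventuallyEq hQF
  refine hQd.congr_deriv ?_
  have hyx : strRadius M (r x) ≠ 0 := (hypos x).ne'
  simp only [hN, hη]
  field_simp

/-- Regrouping identity used in `deriv_core` (pure `ring`). [folklore] -/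
theorem deriv_regroup (y d₁ d₂ ηv η₁ η₂ ηa ε ε' : ℝ) :
    y * (η₁ * (2 + 2 * ηv) + y * η₂ + ε' * (1 + ηv))
      - 2 * (1 - ε) * (ηv + ηv ^ 2 + y * η₁ + ε * (1 + ηv)) =
      y * (d₁ * (2 + 2 * ηa) + y * d₂ + ε' * (1 + ηa))
        + (2 * (y * d₁) * (ηv - ηa) + y * (η₁ - d₁) * (2 + 2 * ηa + 2 * (ηv - ηa))
            + y ^ 2 * (η₂ - d₂) + (y * ε') * (ηv - ηa))
        - 2 * (1 - ε) * ((ηa + ηa ^ 2 + y * d₁ + ε * (1 + ηa))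
            + ((ηv - ηa) * (1 + 2 * ηa + (ηv - ηa) + ε) + y * (η₁ - d₁))) := by
  ring

/-- Pure-inequality core of the sign of `Q′`: with the shift-family pieces `ηa = a/(y−a)`,
`d₁ = −a(1−ε)/(y−a)²`, `d₂ = aε′/(y−a)² + 2a(1−ε)²/(y−a)³` and remainders `δ, p = yδ₁, q = y²δ₂` of size
`κε`, the combination `y N′ − 2(1−ε) N` is `≤ −ε/2`. [folklore] -/
theorem deriv_core {y a ε ε' ηv η₁ η₂ κ ηa d₁ d₂ : ℝ} (hy : 0 < y) (ha0 : 0 ≤ a)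
    (hya : 3 / 4 * y ≤ y - a) (hε0 : 0 < ε) (hε8 : ε ≤ 1 / 8) (hε' : ε' ≤ 0)
    (hε'b : -(4 * ε) ≤ y * ε') (hδ : |ηv - ηa| ≤ κ * ε) (hp : |y * (η₁ - d₁)| ≤ κ * ε)
    (hq : |y ^ 2 * (η₂ - d₂)| ≤ κ * ε)
    (hκ0 : 0 ≤ κ) (hκ : κ ≤ 1 / 10) (hηa : ηa = a / (y - a))
    (hd₁ : d₁ = -(a * (1 - ε)) / (y - a) ^ 2)
    (hd₂ : d₂ = a * ε' / (y - a) ^ 2 + 2 * a * (1 - ε) ^ 2 / (y - a) ^ 3) :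
    y * (η₁ * (2 + 2 * ηv) + y * η₂ + ε' * (1 + ηv))
      - 2 * (1 - ε) * (ηv + ηv ^ 2 + y * η₁ + ε * (1 + ηv))
      ≤ -(ε / 2) := by
  set δ := ηv - ηa with hδ_def
  set p := y * (η₁ - d₁) with hp_def
  set q := y ^ 2 * (η₂ - d₂) with hq_def
  have hya0 : 0 < y - a := by linarith only [hy, hya]
  -- sizes of ηa
  have hηa0 : 0 ≤ ηa := by rw [hηa]; exact div_nonneg ha0 hya0.le
  have hηa3 : ηa ≤ 1 / 3 := by
    rw [hηa, div_le_iff₀ hya0]; linarith only [hya, ha0]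
  -- (F1) the main part of y N′ is ≤ 0
  have hP : y * (d₁ * (2 + 2 * ηa) + y * d₂ + ε' * (1 + ηa)) =
      -(2 * a * ε * (1 - ε) * y ^ 2 / (y - a) ^ 3) + ε' * y ^ 3 / (y - a) ^ 2 := by
    have hyane : y - a ≠ 0 := hya0.ne'
    rw [hηa, hd₁, hd₂]
    field_simp
    ring
  have h1ε : 0 ≤ 1 - ε := by linarith only [hε8]
  have hP0 : y * (d₁ * (2 + 2 * ηa) + y * d₂ + ε' * (1 + ηa)) ≤ 0 := by
    rw [hP]
    have h1 : 0 ≤ 2 * a * ε * (1 - ε) * y ^ 2 / (y - a) ^ 3 := by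
      apply div_nonneg _ (pow_pos hya0 3).le
      positivity
    have h2 : ε' * y ^ 3 / (y - a) ^ 2 ≤ 0 :=
      div_nonpos_of_nonpos_of_nonneg (mul_nonpos_of_nonpos_of_nonneg hε' (pow_pos hy 3).le)
        (pow_pos hya0 2).le
    linarith only [h1, h2]
  -- (F2) |y d₁| ≤ 4/9
  have hyd₁ : |y * d₁| ≤ 4 / 9 := by
    have hden : 0 < (y - a) ^ 2 := pow_pos hya0 2
    have e : y * d₁ = -(a * (1 - ε) * y / (y - a) ^ 2) := by rw [hd₁]; ring
    rw [e, abs_neg, abs_of_nonneg (div_nonneg (by positivity) hden.le), div_le_iff₀ hden]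
    have h916 : 9 / 16 * y ^ 2 ≤ (y - a) ^ 2 := by nlinarith only [hya, hy]
    have ha4 : a ≤ y / 4 := by linarith only [hya]
    have hay : a * (1 - ε) * y ≤ y / 4 * 1 * y := by
      apply mul_le_mul_of_nonneg_right _ hy.le
      exact mul_le_mul ha4 (by linarith only [hε0]) h1ε (by linarith only [hy])
    nlinarith only [hay, h916, hy]
  -- (F3) the remainder of y N′
  obtain ⟨hδl, hδu⟩ := abs_le.1 hδ
  obtain ⟨hpl, hpu⟩ := abs_le.1 hp
  obtain ⟨hql, hqu⟩ := abs_le.1 hq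
  have hκε : κ * ε ≤ 1 / 80 := by
    have : κ * ε ≤ 1 / 10 * ε := mul_le_mul_of_nonneg_right hκ hε0.le
    linarith only [this, hε8]
  have hκε0 : 0 ≤ κ * ε := mul_nonneg hκ0 hε0.le
  have hE : 2 * (y * d₁) * δ + p * (2 + 2 * ηa + 2 * δ) + q + (y * ε') * δ ≤
      26 / 5 * (κ * ε) := by
    have h1 : 2 * (y * d₁) * δ ≤ 8 / 9 * (κ * ε) := by
      have hm : |y * d₁ * δ| ≤ 4 / 9 * (κ * ε) := by
        rw [abs_mul]
        exact mul_le_mul hyd₁ hδ (abs_nonneg _) (by norm_num)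
      have := le_abs_self (y * d₁ * δ)
      linarith only [hm, this]
    have h2 : p * (2 + 2 * ηa + 2 * δ) ≤ κ * ε * (11 / 4) := by
      have hc0 : 0 ≤ 2 + 2 * ηa + 2 * δ := by linarith only [hηa0, hδl, hκε]
      have hc1 : 2 + 2 * ηa + 2 * δ ≤ 11 / 4 := by linarith only [hηa3, hδu, hκε]
      have e1 : p * (2 + 2 * ηa + 2 * δ) ≤ κ * ε * (2 + 2 * ηa + 2 * δ) :=
        mul_le_mul_of_nonneg_right hpu hc0
      have e2 : κ * ε * (2 + 2 * ηa + 2 * δ) ≤ κ * ε * (11 / 4) :=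
        mul_le_mul_of_nonneg_left hc1 hκε0
      exact e1.trans e2
    have h4 : (y * ε') * δ ≤ 1 / 2 * (κ * ε) := by
      have hab : |y * ε'| ≤ 4 * ε := by
        rw [abs_le]
        refine ⟨hε'b, ?_⟩
        have : y * ε' ≤ 0 := mul_nonpos_of_nonneg_of_nonpos hy.le hε'
        linarith only [this, hε0]
      have hm : |y * ε' * δ| ≤ 4 * ε * (κ * ε) := by
        rw [abs_mul]
        exact mul_le_mul hab hδ (abs_nonneg _) (by linarith only [hε0])
      have := le_abs_self (y * ε' * δ)
      have h5 : 4 * ε * (κ * ε) ≤ 1 / 2 * (κ * ε) :=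
        mul_le_mul_of_nonneg_right (by linarith only [hε8]) hκε0
      linarith only [hm, this, h5]
    linarith only [h1, h2, hqu, h4, hκε0]
  -- (F4) the N part: N = m + R with m ∈ [ε, 16ε/9] and |R| ≤ 3κε
  have hsh : ηa + ηa ^ 2 + y * d₁ + ε * (1 + ηa) = ε * y ^ 2 / (y - a) ^ 2 := by
    have hyane : y - a ≠ 0 := hya0.ne'
    rw [hηa, hd₁]
    field_simp
    ring
  obtain ⟨hml, hmu⟩ := main_term_bounds hε0.le ha0 hya hya0
  have hR := remainder_abs_le hδ hp hηa0 hηa3 hε0.le hε8 hκ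
  obtain ⟨hRl, hRu⟩ := abs_le.1 hR
  -- assemble: LHS = (F1) + (F3) − 2(1−ε)(m + R)
  have key := deriv_regroup y d₁ d₂ ηv η₁ η₂ ηa ε ε'
  have h1e : 7 / 8 ≤ 1 - ε := by linarith only [hε8]
  have hN : ε - 3 * (κ * ε) ≤
      (ηa + ηa ^ 2 + y * d₁ + ε * (1 + ηa)) + (δ * (1 + 2 * ηa + δ + ε) + p) := by
    rw [hsh]; linarith only [hml, hRl]
  have hκε' : 3 * (κ * ε) ≤ 3 / 10 * ε := by
    have : κ * ε ≤ 1 / 10 * ε := mul_le_mul_of_nonneg_right hκ hε0.le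
    linarith only [this]
  have hpos : 0 ≤ ε - 3 * (κ * ε) := by linarith only [hκε', hε0]
  have hlow : 2 * (7 / 8) * (ε - 3 * (κ * ε)) ≤
      2 * (1 - ε) * ((ηa + ηa ^ 2 + y * d₁ + ε * (1 + ηa))
        + (δ * (1 + 2 * ηa + δ + ε) + p)) := by
    have := mul_le_mul h1e hN hpos h1ε
    linarith only [this]
  linarith only [key, hP0, hE, hlow, hκε', hε0, hκε0]

/-- **Sign of the derivative**: on `(a′, ∞)` the residual `Q` has a derivative
`≤ −ε/(2y³) < 0`. [folklore] -/
theorem residual_deriv_le (h : PeeledLastRung M r xc W Up Q η' η'' a' a κ) {x : ℝ} (hx : a' < x) :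
    ∃ D, HasDerivAt Q D x ∧ D ≤ -(strDefect M (r x) / (2 * strRadius M (r x) ^ 3)) := by
  refine ⟨_, h.hasDerivAt_residual hx, ?_⟩
  obtain ⟨hy, hε, hε8, hya, hya0, hηa0, hηa⟩ := h.sizes hx
  have hM := h.tortoise.mass_pos
  have h24 := h.far x hx
  have h3 : 3 * M ≤ r x := by linarith
  have hρ0 : 0 < r x := h.tortoise.pos x
  -- ε′ ≤ 0 and y ε′ ≥ −4ε
  obtain ⟨hdl, hdu⟩ := strDefect_comp_deriv_bounds h.tortoise (x := x) h3
  have hε' : lineDefectDeriv M r x ≤ 0 := by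
    unfold lineDefectDeriv
    have : 0 < M / r x ^ 2 := div_pos hM (pow_pos hρ0 2)
    linarith
  have hy2 : strRadius M (r x) ≤ 2 * r x := strRadius_le_two_mul hM h3
  have hεge : 2 * M / r x ≤ strDefect M (r x) := strDefect_ge hM h3
  have hε'b : -(4 * strDefect M (r x)) ≤ strRadius M (r x) * lineDefectDeriv M r x := by
    unfold lineDefectDeriv
    -- y·(−X) ≥ −2r·(4M/r²) = −8M/r ≥ −4ε
    have hX0 : 0 ≤ M / r x ^ 2 * (2 - 3 * M / r x) / Real.sqrt (1 - 2 * M / r x) := by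
      linarith [div_pos hM (pow_pos hρ0 2)]
    have h1 : strRadius M (r x) * (M / r x ^ 2 * (2 - 3 * M / r x) / Real.sqrt (1 - 2 * M / r x))
        ≤ 2 * r x * (4 * M / r x ^ 2) := mul_le_mul hy2 hdu hX0 (by linarith)
    have h2 : 2 * r x * (4 * M / r x ^ 2) = 4 * (2 * M / r x) := by
      field_simp
    rw [h2] at h1
    nlinarith
  have core := deriv_core (ηv := -strRadius M (r x) * W x - 1) (η₁ := η' x) (η₂ := η'' x)
    hy h.shift_nonneg hya hε hε8 hε' hε'b (h.bound₀ x hx) (h.bound₁ x hx) (h.bound₂ x hx)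
    h.kappa_nonneg h.kappa_le rfl rfl rfl
  -- D = (y N′ − 2(1−ε) N)/y³
  have hy3 : 0 < strRadius M (r x) ^ 3 := pow_pos hy 3
  have hyne : strRadius M (r x) ≠ 0 := hy.ne'
  set y := strRadius M (r x) with hy_def
  set A := η' x * (2 + 2 * (-y * W x - 1)) + y * η'' x
    + lineDefectDeriv M r x * (1 + (-y * W x - 1)) with hA
  set B := (-y * W x - 1) + (-y * W x - 1) ^ 2 + y * η' x
    + strDefect M (r x) * (1 + (-y * W x - 1)) with hB
  have e1 : A / y ^ 2 - 2 * (1 - strDefect M (r x)) * B / y ^ 3 =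
      (y * A - 2 * (1 - strDefect M (r x)) * B) / y ^ 3 := by
    field_simp
  have e2 : -(strDefect M (r x) / (2 * y ^ 3)) = (-(strDefect M (r x) / 2)) / y ^ 3 := by
    field_simp
  rw [e1, e2]
  exact div_le_div_of_nonneg_right core hy3.le

/-- **The peeled residual is strictly decreasing on `(a′, ∞)`.** [folklore] -/
theorem residual_strictAntiOn (h : PeeledLastRung M r xc W Up Q η' η'' a' a κ) :
    StrictAntiOn Q (Ioi a') := by
  have hcont : ContinuousOn Q (Ioi a') := fun x hx =>
    (h.hasDerivAt_residual hx).continuousAt.continuousWithinAt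
  refine strictAntiOn_of_deriv_neg (convex_Ioi a') hcont ?_
  intro x hx
  rw [interior_Ioi] at hx
  obtain ⟨D, hD, hDle⟩ := h.residual_deriv_le hx
  obtain ⟨hy, hε, -⟩ := h.sizes hx
  rw [hD.deriv]
  have : 0 < strDefect M (r x) / (2 * strRadius M (r x) ^ 3) := by positivity
  linarith

/-- **Pointwise decay**: `Q ≤ 9M/r³` on `(a′, ∞)`. [folklore] -/
theorem residual_le (h : PeeledLastRung M r xc W Up Q η' η'' a' a κ) {x : ℝ} (hx : a' < x) :
    Q x ≤ 9 * M / r x ^ 3 := by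
  obtain ⟨hy, hε, -⟩ := h.sizes hx
  have hM := h.tortoise.mass_pos
  have h24 := h.far x hx
  have h3 : 3 * M ≤ r x := by linarith
  have hρ0 : 0 < r x := h.tortoise.pos x
  have hub := (h.sq_mul_residual_bounds hx).2
  -- ε ≤ 3M/r and r ≤ y
  have hεle : strDefect M (r x) ≤ 3 * M / r x := by
    have h1 := strDefect_le hM h3
    have h2 : 3 * M ^ 2 / r x ^ 2 ≤ M / r x := by
      rw [div_le_div_iff₀ (pow_pos hρ0 2) hρ0]
      have e1 : 3 * M ^ 2 * r x = M * r x * (3 * M) := by ring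
      have e2 : M * r x ^ 2 = M * r x * r x := by ring
      rw [e1, e2]
      exact mul_le_mul_of_nonneg_left h3 (mul_nonneg hM.le hρ0.le)
    have e : 3 * M / r x = 2 * M / r x + M / r x := by ring
    linarith
  have hry : r x ≤ strRadius M (r x) := le_strRadius hM.le (h.tortoise.two_mul_lt x)
  -- Q ≤ 3ε/y² ≤ 9M/(r y²) ≤ 9M/r³
  have hQ : Q x ≤ 3 * strDefect M (r x) / strRadius M (r x) ^ 2 := by
    rw [le_div_iff₀ (pow_pos hy 2)]; linarith
  calc Q x ≤ 3 * strDefect M (r x) / strRadius M (r x) ^ 2 := hQ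
    _ ≤ 3 * (3 * M / r x) / strRadius M (r x) ^ 2 := by
        apply div_le_div_of_nonneg_right _ (pow_pos hy 2).le; linarith
    _ ≤ 3 * (3 * M / r x) / r x ^ 2 := by
        apply div_le_div_of_nonneg_left _ (pow_pos hρ0 2) (pow_le_pow_left₀ hρ0.le hry 2)
        positivity
    _ = 9 * M / r x ^ 3 := by field_simp; ring

/-- Elementary: `t²/(A + t/3)³ ≤ 4/(3A)` for `A > 0`, `t ≥ 0`
(since `4(A+u)³ − 27Au² = (A + 4u)(2A − u)² ≥ 0`, `u = t/3`). [folklore] -/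
theorem sq_div_cube_le {A t : ℝ} (hA : 0 < A) (ht : 0 ≤ t) :
    t ^ 2 / (A + t / 3) ^ 3 ≤ 4 / (3 * A) := by
  have hden : 0 < (A + t / 3) ^ 3 := by positivity
  rw [div_le_div_iff₀ hden (by positivity)]
  have key : 4 * (A + t / 3) ^ 3 - 3 * A * t ^ 2 = (A + 4 * (t / 3)) * (2 * A - t / 3) ^ 2 := by
    ring
  nlinarith [key, mul_nonneg (by positivity : (0:ℝ) ≤ A + 4 * (t / 3)) (sq_nonneg (2 * A - t / 3))]

/-- **Hardy size of the peeled residual**: `t² Q(x_f + t) ≤ 12 M / r(x_f)` for `x_f > a′`,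
`t > 0`; in particular `≤ 1/16` once `r(x_f) ≥ 192 M`. [folklore] -/
theorem sq_mul_residual_translate_le (h : PeeledLastRung M r xc W Up Q η' η'' a' a κ) {xf t : ℝ}
    (hxf : a' < xf) (ht : 0 < t) : t ^ 2 * Q (xf + t) ≤ 12 * M / r xf := by
  have hM := h.tortoise.mass_pos
  have hx : a' < xf + t := by linarith
  have hQ := h.residual_le hx
  have hrf0 : 0 < r xf := h.tortoise.pos xf
  -- r(xf + t) ≥ r(xf) + t/3
  have hgrow : r xf + t / 3 ≤ r (xf + t) := by
    have hcont : ContinuousOn r (Ici xf) := h.tortoise.continuous.continuousOn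
    have hdiff : DifferentiableOn ℝ r (interior (Ici xf)) := fun s _ =>
      (h.tortoise.hasDerivAt s).differentiableAt.differentiableWithinAt
    have hbound : ∀ s ∈ interior (Ici xf), (1 / 3 : ℝ) ≤ deriv r s := by
      intro s hs
      rw [interior_Ici] at hs
      rw [(h.tortoise.hasDerivAt s).deriv]
      have hs' : a' < s := lt_trans hxf hs
      have h24 := h.far s hs'
      have hrs : 0 < r s := h.tortoise.pos s
      have : 2 * M / r s ≤ 1 / 12 := by rw [div_le_iff₀ hrs]; linarith
      linarith
    have := (convex_Ici xf).mul_sub_le_image_sub_of_le_deriv hcont hdiff hbound xf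
      self_mem_Ici (xf + t) (by simp [ht.le]) (by linarith)
    linarith
  have hrt0 : 0 < r (xf + t) := h.tortoise.pos (xf + t)
  calc t ^ 2 * Q (xf + t) ≤ t ^ 2 * (9 * M / r (xf + t) ^ 3) :=
        mul_le_mul_of_nonneg_left hQ (sq_nonneg t)
    _ = 9 * M * (t ^ 2 / r (xf + t) ^ 3) := by ring
    _ ≤ 9 * M * (t ^ 2 / (r xf + t / 3) ^ 3) := by
        apply mul_le_mul_of_nonneg_left _ (by positivity)
        apply div_le_div_of_nonneg_left (sq_nonneg t) (by positivity)
        exact pow_le_pow_left₀ (by positivity) hgrow 3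
    _ ≤ 9 * M * (4 / (3 * r xf)) :=
        mul_le_mul_of_nonneg_left (sq_div_cube_le hrf0 ht.le) (by positivity)
    _ = 12 * M / r xf := by field_simp; ring

/-- **Packaging for stub R.**  Under `PeeledLastRung` with `x_f > a′` and `r(x_f) ≥ 192 M`:
`Q ≥ 0` on `(a′, ∞)`, `Q` is antitone on `[x_f, ∞)`, and `t² Q(x_f + t) ≤ 1/16` for all `t > 0`.
[folklore] -/
theorem residual_subHardy (h : PeeledLastRung M r xc W Up Q η' η'' a' a κ) {xf : ℝ}
    (hxf : a' < xf) (hfar : 192 * M ≤ r xf) :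
    (∀ x, a' < x → 0 ≤ Q x) ∧ AntitoneOn Q (Ici xf) ∧
      ∀ t : ℝ, 0 < t → t ^ 2 * Q (xf + t) ≤ 1 / 16 := by
  have hM := h.tortoise.mass_pos
  refine ⟨fun x hx => (h.residual_pos hx).le, ?_, fun t ht => ?_⟩
  · exact (h.residual_strictAntiOn.antitoneOn).mono (fun x hx => lt_of_lt_of_le hxf hx)
  · have := h.sq_mul_residual_translate_le hxf ht
    have hrf0 : 0 < r xf := h.tortoise.pos xf
    have : 12 * M / r xf ≤ 1 / 16 := by
      rw [div_le_iff₀ hrf0]; linarith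
    linarith

end PeeledLastRung

end ReggeWheeler

end Literature.Geometry.Lorentzian
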